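import Summits.Ventures.HodgeKum4.Statement
import Summits.HodgeConjecture.HodgeConjecture.Theorems.Ring2AbelianAllAndreCorrespondenceCategory
import Summits.HodgeConjecture.CorCM.Stage4StrictRoadDischargePowers
import Literature.AlgebraicGeometry.HodgeTheory.MotivatedClassesAlgebraic
import Literature.AlgebraicGeometry.HodgeTheory.CorrespondenceCupProductIdentities
import Literature.AlgebraicGeometry.HodgeTheory.ComplexGysin
import HarnessLib

/-!
# Dominated classes are stable under algebraic correspondences and under cup product
(cell `hodge-kum4`, seat p2; bookkeeping for the span-form node L2a′ `GammaInvariantsDominatedKum4` of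
route `KummerFixedLocus`, `Summits/Ventures/HodgeKum4/Statement.lean` §6)

HONEST FRAMING.  Pure bookkeeping on the tree's real carriers, no named fact: for `Y`, `B` smooth
projective, the submodules `dominatedClasses dY Y dX B k ⊆ Hᵏ(Y(ℂ); ℂ)` (the `ℂ`-span of the images
of algebraic correspondences from the cartesian powers `Bᵉ`) satisfy
* `dominatedClasses_map_le` — an algebraic correspondence `R : Hᵏ(Y) → H^{k'}(Y')` carries dominated
  classes to dominated classes (`R ∘ T` is algebraic: ring 2's `IsAlgebraicCorrespondence.comp`,
  Fulton Prop. 16.1.1);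
* `cupProduct_mem_dominatedClasses` — the cup product of two dominated classes is dominated (the class
  version of Stage 4's `isDominatedByPowers_tensor`: external products of correspondences
  `exists_isAlgebraicCorrespondence_whiskerLeft`, the braiding, `Bᶠ ⊗ Bᵉ ≅ B^{f+e}`, and `Δ^*`).
These are steps (ii) of the kernel plan for L2a′ (HOME STATUS 2026-08-25T23:09Z, director GO 23:10Z).
-/

noncomputable section

open CategoryTheory MonoidalCategory CartesianMonoidalCategory
open Literature.AlgebraicGeometry Literature.AlgebraicGeometry.Motives Literature.AlgebraicGeometry.HodgeTheory
open Literature.AlgebraicTopology.SingularHomology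
open Summit.HodgeConjecture.HodgeConjecture.Ring2.AbelianAll (IsAlgebraicCorrespondence.comp
  IsAlgebraicCorrespondence.le_two_mul)
open Summit.HodgeConjecture.CorCM.Stage4 (exists_isAlgebraicCorrespondence_whiskerLeft
  isAlgebraicCorrespondence_source_le map_braiding_hom_cross nonempty_powTensorPowIso)

namespace Summit.Ventures.HodgeKum4

variable {dY dY' dX : ℕ} {Y Y' B : SchemeOver ℂ}

/-- A generator of `dominatedClasses`: the image of an algebraic correspondence from `Bᵉ`. -/
theorem mem_dominatedClasses_of_apply {k e a : ℕ}
    {T : complexBetti (B.pow e) a →ₗ[ℂ] complexBetti Y k}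
    (hT : IsAlgebraicCorrespondence dY (e * dX) Y (B.pow e) T) (x : complexBetti (B.pow e) a) :
    T x ∈ dominatedClasses dY Y dX B k :=
  Submodule.subset_span ⟨e, a, T, hT, LinearMap.mem_range_self T x⟩

/-- **Algebraic correspondences carry dominated classes to dominated classes**: for `R : Hᵏ(Y) → H^{k'}(Y')`
induced by an algebraic correspondence, `R(dominatedClasses Y) ⊆ dominatedClasses Y'` (composition
`R ∘ T` with the dominating correspondences; a generator from `Bᵉ` of source degree above `2 dim Bᵉ`
is `0`). -/
theorem dominatedClasses_map_le (hY : IsSmoothProjective dY Y) (hY' : IsSmoothProjective dY' Y')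
    (hB : IsSmoothProjective dX B) {k k' : ℕ} {R : complexBetti Y k →ₗ[ℂ] complexBetti Y' k'}
    (hR : IsAlgebraicCorrespondence dY' dY Y' Y R) :
    (dominatedClasses dY Y dX B k).map R ≤ dominatedClasses dY' Y' dX B k' := by
  rw [dominatedClasses, Submodule.map_span_le]
  rintro c ⟨e, a, T, hT, x, rfl⟩
  by_cases ha : a ≤ 2 * (e * dX)
  · exact mem_dominatedClasses_of_apply
      (IsAlgebraicCorrespondence.comp hY' hY (hB.pow e) hT hR (by omega)) x
  · haveI := subsingleton_complexBetti (hB.pow e) (not_le.1 ha)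
    rw [Subsingleton.elim x 0, map_zero, map_zero]
    exact Submodule.zero_mem _

/-- Element form of `dominatedClasses_map_le`. -/
theorem apply_mem_dominatedClasses (hY : IsSmoothProjective dY Y) (hY' : IsSmoothProjective dY' Y')
    (hB : IsSmoothProjective dX B) {k k' : ℕ} {R : complexBetti Y k →ₗ[ℂ] complexBetti Y' k'}
    (hR : IsAlgebraicCorrespondence dY' dY Y' Y R) {c : complexBetti Y k}
    (hc : c ∈ dominatedClasses dY Y dX B k) : R c ∈ dominatedClasses dY' Y' dX B k' :=
  dominatedClasses_map_le hY hY' hB hR (Submodule.mem_map_of_mem hc)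

/-- Pull-backs carry dominated classes to dominated classes. -/
theorem map_mem_dominatedClasses (hY : IsSmoothProjective dY Y) (hY' : IsSmoothProjective dY' Y')
    (hB : IsSmoothProjective dX B) (f : Y' ⟶ Y) {k : ℕ} (hk : k ≤ 2 * dY') {c : complexBetti Y k}
    (hc : c ∈ dominatedClasses dY Y dX B k) :
    complexBetti.map f k c ∈ dominatedClasses dY' Y' dX B k :=
  apply_mem_dominatedClasses hY hY' hB (isAlgebraicCorrespondence_map hY' hY f hk) hc

/-- **The cross product of two dominating generators is dominated** (on `Y ⊗ Y`, by `B^{e₂+e₁}`) — the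
inner computation of Stage 4's `isDominatedByPowers_tensor`, class by class: for `T : H^{a₁}(B^{e₁}) → Hⁱ(Y)`
and `S : H^{a₂}(B^{e₂}) → Hʲ(Y)` algebraic, `pr₁^*(T z₀) ∪ pr₂^*(S x₀) = ± R((φ⁻¹)^*(pr^* x₀ ∪ pr^* z₀))`
with `R = (Y ⊗ S) ∘ β^* ∘ (B^{e₂} ⊗ T) ∘ φ^*` algebraic. -/
theorem cross_mem_dominatedClasses (hY : IsSmoothProjective dY Y) (hB : IsSmoothProjective dX B)
    {i j k : ℕ} (hij : i + j = k) {e₁ a₁ e₂ a₂ : ℕ}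
    {T : complexBetti (B.pow e₁) a₁ →ₗ[ℂ] complexBetti Y i}
    (hT : IsAlgebraicCorrespondence dY (e₁ * dX) Y (B.pow e₁) T)
    {S : complexBetti (B.pow e₂) a₂ →ₗ[ℂ] complexBetti Y j}
    (hS : IsAlgebraicCorrespondence dY (e₂ * dX) Y (B.pow e₂) S)
    (z₀ : complexBetti (B.pow e₁) a₁) (x₀ : complexBetti (B.pow e₂) a₂) :
    cupProduct hij (complexBetti.map (fst Y Y) i (T z₀)) (complexBetti.map (snd Y Y) j (S x₀)) ∈
      dominatedClasses (dY + dY) (Y ⊗ Y) dX B k := by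
  -- adapted from Summits/HodgeConjecture/CorCM/Stage4StrictRoadDischargePowers `isDominatedByPowers_tensor`
  have hYY := IsSmoothProjective.tensor_holds hY hY
  have hi : i ≤ 2 * dY := IsAlgebraicCorrespondence.le_two_mul hT
  have hj : j ≤ 2 * dY := IsAlgebraicCorrespondence.le_two_mul hS
  have ha₁i : a₁ ≤ i + 2 * (e₁ * dX) := isAlgebraicCorrespondence_source_le hT
  have ha₂j : a₂ ≤ j + 2 * (e₂ * dX) := isAlgebraicCorrespondence_source_le hS
  have hde : (e₂ + e₁) * dX = e₂ * dX + e₁ * dX := Nat.add_mul e₂ e₁ dX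
  by_cases ha₁ : a₁ ≤ 2 * (e₁ * dX); swap
  · haveI := subsingleton_complexBetti (hB.pow e₁) (not_le.1 ha₁)
    rw [Subsingleton.elim z₀ 0, map_zero, map_zero, map_zero, LinearMap.zero_apply]
    exact Submodule.zero_mem _
  by_cases ha₂ : a₂ ≤ 2 * (e₂ * dX); swap
  · haveI := subsingleton_complexBetti (hB.pow e₂) (not_le.1 ha₂)
    rw [Subsingleton.elim x₀ 0, map_zero, map_zero, map_zero]
    exact Submodule.zero_mem _
  obtain ⟨W₁, hW₁, hW₁v⟩ := exists_isAlgebraicCorrespondence_whiskerLeft hY hY (hB.pow e₂) hS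
    (j := i) (k := a₂ + i) (k' := k) (by omega) hij (by omega)
  obtain ⟨W₂, hW₂, hW₂v⟩ := exists_isAlgebraicCorrespondence_whiskerLeft (hB.pow e₂) hY (hB.pow e₁) hT
    (j := a₂) (k := a₂ + a₁) (k' := a₂ + i) rfl rfl (by omega)
  obtain ⟨φ⟩ := nonempty_powTensorPowIso B e₂ e₁
  have hBB := IsSmoothProjective.tensor_holds (hB.pow e₂) (hB.pow e₁)
  have hBY := IsSmoothProjective.tensor_holds (hB.pow e₂) hY
  have hYB := IsSmoothProjective.tensor_holds hY (hB.pow e₂)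
  have hσ : IsAlgebraicCorrespondence (dY + e₂ * dX) (e₂ * dX + dY) (Y ⊗ B.pow e₂) (B.pow e₂ ⊗ Y)
      (complexBetti.map (β_ Y (B.pow e₂)).hom (a₂ + i)).hom :=
    isAlgebraicCorrespondence_map hYB hBY (β_ Y (B.pow e₂)).hom (by omega)
  have hφ : IsAlgebraicCorrespondence (e₂ * dX + e₁ * dX) ((e₂ + e₁) * dX) (B.pow e₂ ⊗ B.pow e₁)
      (B.pow (e₂ + e₁)) (complexBetti.map φ.hom (a₂ + a₁)).hom :=
    isAlgebraicCorrespondence_map hBB (hB.pow (e₂ + e₁)) φ.hom (by omega)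
  set R : complexBetti (B.pow (e₂ + e₁)) (a₂ + a₁) →ₗ[ℂ] complexBetti (Y ⊗ Y) k :=
    W₁ ∘ₗ (complexBetti.map (β_ Y (B.pow e₂)).hom (a₂ + i)).hom ∘ₗ W₂ ∘ₗ
      (complexBetti.map φ.hom (a₂ + a₁)).hom with hR
  have hRalg : IsAlgebraicCorrespondence (dY + dY) ((e₂ + e₁) * dX) (Y ⊗ Y) (B.pow (e₂ + e₁)) R := by
    refine IsAlgebraicCorrespondence.comp hYY hYB (hB.pow _) ?_ hW₁ (by omega)
    refine IsAlgebraicCorrespondence.comp hYB hBY (hB.pow _) ?_ hσ (by omega)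
    exact IsAlgebraicCorrespondence.comp hBY hBB (hB.pow _) hφ hW₂ (by omega)
  set y₀ : complexBetti (B.pow e₂ ⊗ B.pow e₁) (a₂ + a₁) :=
    cupProduct (rfl : a₂ + a₁ = a₂ + a₁) (complexBetti.map (fst (B.pow e₂) (B.pow e₁)) a₂ x₀)
      (complexBetti.map (snd (B.pow e₂) (B.pow e₁)) a₁ z₀) with hy₀
  have hRy : R (complexBetti.map φ.inv (a₂ + a₁) y₀) =
      ((-1 : ℂ) ^ (a₂ * i)) •
        cupProduct hij (complexBetti.map (fst Y Y) i (T z₀)) (complexBetti.map (snd Y Y) j (S x₀)) := by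
    rw [hR, LinearMap.comp_apply, LinearMap.comp_apply, LinearMap.comp_apply]
    have e1 : (complexBetti.map φ.hom (a₂ + a₁)).hom (complexBetti.map φ.inv (a₂ + a₁) y₀) = y₀ := by
      change complexBetti.map φ.hom _ (complexBetti.map φ.inv _ y₀) = y₀
      rw [← complexBetti.map_comp_apply', Iso.hom_inv_id, complexBetti.map_id]
      rfl
    rw [e1, hy₀, hW₂v x₀ z₀]
    change W₁ (complexBetti.map (β_ Y (B.pow e₂)).hom (a₂ + i) _) = _
    rw [map_braiding_hom_cross (rfl : a₂ + i = a₂ + i) (show i + a₂ = a₂ + i by omega) (T z₀) x₀, map_smul,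
      hW₁v]
  have hmem : R (((-1 : ℂ) ^ (a₂ * i)) • complexBetti.map φ.inv (a₂ + a₁) y₀) ∈
      dominatedClasses (dY + dY) (Y ⊗ Y) dX B k := mem_dominatedClasses_of_apply hRalg _
  have hsign : ((-1 : ℂ) ^ (a₂ * i)) * ((-1 : ℂ) ^ (a₂ * i)) = 1 := by
    rw [← pow_add, ← two_mul, pow_mul, neg_one_sq, one_pow]
  rw [map_smul, hRy, smul_smul, hsign, one_smul] at hmem
  exact hmem

/-- **The cup product of two dominated classes is dominated**: `c₁ ∪ c₂ = Δ^*(pr₁^* c₁ ∪ pr₂^* c₂)`,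
the cross product of generators is dominated on `Y ⊗ Y` (`cross_mem_dominatedClasses`), the cup
product is bilinear, and `Δ^*` is an algebraic correspondence. -/
theorem cupProduct_mem_dominatedClasses (hY : IsSmoothProjective dY Y) (hB : IsSmoothProjective dX B)
    {i j k : ℕ} (hij : i + j = k) {c₁ : complexBetti Y i} {c₂ : complexBetti Y j}
    (h₁ : c₁ ∈ dominatedClasses dY Y dX B i) (h₂ : c₂ ∈ dominatedClasses dY Y dX B j) :
    cupProduct hij c₁ c₂ ∈ dominatedClasses dY Y dX B k := by
  classical
  have hYY := IsSmoothProjective.tensor_holds hY hY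
  by_cases hk : k ≤ 2 * dY; swap
  · haveI := subsingleton_complexBetti hY (not_le.1 hk)
    rw [Subsingleton.elim (cupProduct hij c₁ c₂) 0]
    exact Submodule.zero_mem _
  -- the diagonal and `c₁ ∪ c₂ = Δ^*(pr₁^* c₁ ∪ pr₂^* c₂)`
  obtain ⟨Δ, hΔfst, hΔsnd⟩ : ∃ Δ : Y ⟶ Y ⊗ Y, Δ ≫ fst Y Y = 𝟙 Y ∧ Δ ≫ snd Y Y = 𝟙 Y :=
    ⟨lift (𝟙 Y) (𝟙 Y), lift_fst _ _, lift_snd _ _⟩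
  have hcup : ∀ (a : complexBetti Y i) (b : complexBetti Y j), cupProduct hij a b =
      complexBetti.map Δ k
        (cupProduct hij (complexBetti.map (fst Y Y) i a) (complexBetti.map (snd Y Y) j b)) := by
    intro a b
    rw [complexBetti.map_cupProduct, ← complexBetti.map_comp_apply', ← complexBetti.map_comp_apply',
      hΔfst, hΔsnd, complexBetti.map_id, complexBetti.map_id]
    rfl
  -- bilinear reduction to generators
  set Φ : complexBetti Y i →ₗ[ℂ] complexBetti Y j →ₗ[ℂ] complexBetti (Y ⊗ Y) k :=
    (cupProduct hij).compl₁₂ (complexBetti.map (fst Y Y) i).hom (complexBetti.map (snd Y Y) j).hom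
    with hΦ
  have hcross : Φ c₁ c₂ ∈ dominatedClasses (dY + dY) (Y ⊗ Y) dX B k := by
    have h12 := Submodule.apply_mem_map₂ Φ h₁ h₂
    rw [dominatedClasses, dominatedClasses, Submodule.map₂_span_span] at h12
    refine Submodule.span_le.2 ?_ h12
    rintro _ ⟨_, ⟨e₁, a₁, T, hT, z₀, rfl⟩, _, ⟨e₂, a₂, S, hS, x₀, rfl⟩, rfl⟩
    exact cross_mem_dominatedClasses hY hB hij hT hS z₀ x₀
  rw [hcup c₁ c₂]
  exact map_mem_dominatedClasses hYY hY hB Δ hk hcross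

end Summit.Ventures.HodgeKum4

end
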